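import Literature.Probability.RandomPlanarGeometry.SAWCountZdSymbolLeadingCoefficient
import HarnessLib

/-!
# SYMBOL SECOND LAYER: `[X^{2j−4}] R_j` is λ's top shape sum plus TWO new shape sums, for every `j ≥ 2`

Topic `Literature/Probability/RandomPlanarGeometry` (the «SYMBOL POLYNOMIALITY» programme; on `SAWCountZdSymbolLeadingCoefficient.lean` (a-p1 g25, λ4: `topShapeSum`,
`topShapeSum_eq : S_j = (2j−3)(2j−5)‼2^{2j−2}`, `coeff_symbolPoly_two_mul_sub_three`, `natDegree_symbolPoly`), `SAWCountZdSymbolDegree.lean` (η: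
`breaks_add_three_le_of_mem_shapeClass`), `SAWCountZdSymbolPolynomiality.lean` (β: `symbolPoly`, `shapeClass_eq_empty`, `breaks_pos_of_valid`)).

PRINTED CONTEXT (locators only; nothing is quoted digit-for-digit). Madras–Slade (1993) §1.1 eq. (1.1.8) p. 5 (the `1/d` expansion of `μ`), Definition 1.2.4,
§1.2 p. 10; Clisby–Liang–Slade (2007) §3.3 eqs. (29)/(31); Stanley EC1 §1.3 Prop. 1.3.7 eq. (1.28) (falling factorials and Stirling numbers). NOT IN PRINT as
far as the lane's desks could locate: the statements below (lane theorems about the lane's own `R_j = symbolPoly j`).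

THE THEOREM. `R_j(X) = Σ_{u ≤ 2j} Σ_{A valid} #shapeClass_j(u,A)·2^{−u}·C(X+1−u, breaks A)`; a non-empty class has `breaks A + 3 ≤ u ≤ 2j` (η), so
`X^{2j−4}` is reached only at the three corners `(u, breaks) = (2j, 2j−3)` (λ's top classes, one coefficient below their top), `(2j, 2j−4)` and
`(2j−1, 2j−4)` (at their top). HERE: `coeff_descPochhammer_succ_comp_X_add_C` (`[X^b] (X)_{b+1}∘(X+c) = (b+1)c − (b+1)b/2`); the two SECOND-LAYER
SHAPE SUMS `secondShapeSumTop j = U'_j = Σ_{A valid on 2j, breaks = 2j−4} #class`, `secondShapeSumBelow j = V'_j = Σ_{A valid on 2j−1, breaks = 2j−4} #class`;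
★★★ `coeff_symbolPoly_two_mul_sub_four`: **`[X^{2j−4}] R_j = S_j·2^{−2j}/(2j−3)!·(−3(2j−3)(j−1)) + U'_j·2^{−2j}/(2j−4)! + V'_j·2^{−(2j−1)}/(2j−4)!`** for every
`j ≥ 2`; ★★ `coeff_symbolPoly_two_mul_sub_four_of_sums`: IF `U'_j = (2j−4)(4j−7)(2j−5)‼2^{2j−3}` and `3V'_j = (2j−4)(j+3)(2j−5)‼2^{2j−3}` (the lane's census values
`U' = 3456, 149760, 7311360, 406425600` (`j = 4…7`), `V' = 896, 30720, 1290240` (`j = 4…6`) fit; pen-and-paper derivation + blind predictions `V'_7 = 64 512 000`,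
`U'_8, V'_8` in FINDING-ZD-SYMBOL-POLYNOMIALITY §15 / register «Am. BQ») THEN **`[X^{2j−4}] R_j = −(4j² − 2j − 3)/(3·2^j·(j−2)!)`** (tree instances: `−9/8, −53/96,
−29/192, −645/23040` for `j = 3…6`). The two closed forms are the next all-`j` census theorems of the programme (OPEN here; they discharge the SECOND CANCELLATION).
Tool notions (the lane's): `secondShapeSumTop`, `secondShapeSumBelow`.

THIS FILE (lane «pcv-sawmu», a-p1 g26; all PROVED, standard axioms): `coeff_descPochhammer_succ_comp_X_add_C` (private, generic), `secondShapeSumTop`, `secondShapeSumBelow`,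
`coeff_symbolPoly_term_eq_zero_of_breaks_lt`, `symbolPoly_term_eq_zero_of_card_eq_zero`, `coeff_symbolPoly_term_sub_four_eq_zero`, `coeff_symbolPoly_term_top_sub_four`,
`coeff_symbolPoly_term_second`, ★★★ `coeff_symbolPoly_two_mul_sub_four`, ★★ `coeff_symbolPoly_two_mul_sub_four_of_sums`.
[cite: MadrasSlade1993, §1.1 eq. (1.1.8) p. 5; Definition 1.2.4; §1.2 (p. 10)] [cite: ClisbyLiangSlade2007, §3.3 eqs. (29)/(31)] [cite: Stanley2012EC1, §1.3 Prop. 1.3.7 eq. (1.28)]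

Provenance: lane «pcv-sawmu», a-p1 g26 (2026-08-28).
-/

open Finset
open scoped BigOperators
open Literature.Probability.LatticeModels
open Literature.Probability.RandomPlanarGeometry.SAW
open Literature.Probability.Percolation

namespace Literature.Probability.RandomPlanarGeometry.SAW.Zd

namespace WordTypes

variable {u : ℕ}

/-! ### The second coefficient of a shifted falling factorial -/

open Polynomial in
/-- `[X^b] (X(X−1)⋯(X−b)) ∘ (X + c) = (b+1)·c − (b+1)b/2`: the second coefficient of the shifted falling factorial of degree `b + 1` (sum of the
roots `c, c−1, …, c−b` negated). [cite: Stanley2012EC1, §1.3 Prop. 1.3.7 eq. (1.28); lane lemma] -/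
private theorem coeff_descPochhammer_succ_comp_X_add_C (b : ℕ) (c : ℚ) :
    ((descPochhammer ℚ (b + 1)).comp (Polynomial.X + Polynomial.C c)).coeff b = ((b : ℚ) + 1) * c - ((b : ℚ) + 1) * b / 2 := by
  induction b with
  | zero => simp
  | succ b ih =>
    set P : Polynomial ℚ := (descPochhammer ℚ (b + 1)).comp (Polynomial.X + Polynomial.C c) with hP
    have hmon : P.Monic := (monic_descPochhammer ℚ _).comp_X_add_C _
    have hdeg : P.natDegree = b + 1 := by
      rw [hP, Polynomial.natDegree_comp, descPochhammer_natDegree, Polynomial.natDegree_X_add_C, mul_one]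
    have htop : P.coeff (b + 1) = 1 := by
      have := hmon.coeff_natDegree; rwa [hdeg] at this
    have hcomp : (descPochhammer ℚ (b + 1 + 1)).comp (Polynomial.X + Polynomial.C c) = P * Polynomial.X + Polynomial.C (c - (b + 1 : ℚ)) * P := by
      rw [descPochhammer_succ_right, Polynomial.mul_comp, Polynomial.sub_comp, Polynomial.X_comp, ← hP,
        show ((b + 1 : ℕ) : Polynomial ℚ) = Polynomial.C ((b + 1 : ℕ) : ℚ) by rw [Polynomial.C_eq_natCast], Polynomial.C_comp]
      push_cast
      rw [map_sub, map_add, map_one]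
      ring
    rw [hcomp, Polynomial.coeff_add, Polynomial.coeff_mul_X, Polynomial.coeff_C_mul, ih, htop]
    push_cast
    ring

/-! ### The two second-layer shape sums -/

open Classical in
/-- The SECOND-LAYER TOP SUM `U'_j = Σ_{A valid on 2j letters, breaks A = 2j − 4} #shapeClass_j(2j, A)` (four adjacencies on `2j` letters: run types
`{5}` and `{4,2}`; the lane's census value `M_j(2j, 2j−4)`: `3456, 149760, 7311360, 406425600` for `j = 4…7`). [cite: MadrasSlade1993, Definition 1.2.4; lane tool notion] -/
noncomputable def secondShapeSumTop (j : ℕ) : ℕ :=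
  ∑ A : Fin (2 * j) → Bool, if AdjValid A ∧ breaks A = 2 * j - 4 then (shapeClass j (2 * j) A).card else 0

open Classical in
/-- The SECOND-LAYER LOWER SUM `V'_j = Σ_{A valid on 2j − 1 letters, breaks A = 2j − 4} #shapeClass_j(2j−1, A)` (one run of four on `2j − 1` letters,
one axis thrice; the census value `M_j(2j−1, 2j−4)`: `896, 30720, 1290240` for `j = 4, 5, 6`). [cite: MadrasSlade1993, Definition 1.2.4; lane tool notion] -/
noncomputable def secondShapeSumBelow (j : ℕ) : ℕ :=
  ∑ A : Fin (2 * j - 1) → Bool, if AdjValid A ∧ breaks A = 2 * j - 4 then (shapeClass j (2 * j - 1) A).card else 0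

/-! ### Which terms of `symbolPoly j` reach `X^{2j−4}` -/

open Classical Polynomial in
/-- A term with `breaks A < m` has no `X^m` coefficient (its degree is `breaks A`). [cite: MadrasSlade1993, Definition 1.2.4; lane plumbing] -/
theorem coeff_symbolPoly_term_eq_zero_of_breaks_lt (j u : ℕ) (A : Fin u → Bool) {m : ℕ} (h : breaks A < m) :
    (Polynomial.C (((shapeClass j u A).card : ℚ) * (1 / 2) ^ u / ((breaks A).factorial : ℚ)) *
        (descPochhammer ℚ (breaks A)).comp (Polynomial.X + Polynomial.C ((1 : ℚ) - u))).coeff m = 0 := by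
  apply Polynomial.coeff_eq_zero_of_natDegree_lt
  refine lt_of_le_of_lt ((Polynomial.natDegree_C_mul_le _ _).trans Polynomial.natDegree_comp_le) ?_
  rw [descPochhammer_natDegree, Polynomial.natDegree_X_add_C, mul_one]
  exact h

open Classical Polynomial in
/-- A term with an empty class vanishes. [cite: MadrasSlade1993, Definition 1.2.4; lane plumbing] -/
theorem symbolPoly_term_eq_zero_of_card_eq_zero (j u : ℕ) (A : Fin u → Bool) (h : (shapeClass j u A).card = 0) :
    Polynomial.C (((shapeClass j u A).card : ℚ) * (1 / 2) ^ u / ((breaks A).factorial : ℚ)) *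
        (descPochhammer ℚ (breaks A)).comp (Polynomial.X + Polynomial.C ((1 : ℚ) - u)) = 0 := by
  rw [h]; simp

open Classical Polynomial in
/-- Off the three corners `(u, breaks) ∈ {(2j, 2j−3), (2j, 2j−4), (2j−1, 2j−4)}` a term of `symbolPoly j` has no `X^{2j−4}` coefficient (`j ≥ 2`):
a non-empty class needs `breaks + 3 ≤ u ≤ 2j`. [cite: MadrasSlade1993, Definition 1.2.4; lane plumbing] -/
theorem coeff_symbolPoly_term_sub_four_eq_zero (j u : ℕ) (A : Fin u → Bool) (hj : 2 ≤ j)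
    (h : ¬ ((u = 2 * j ∧ breaks A = 2 * j - 3) ∨ (u = 2 * j ∧ breaks A = 2 * j - 4) ∨ (u = 2 * j - 1 ∧ breaks A = 2 * j - 4))) :
    (Polynomial.C (((shapeClass j u A).card : ℚ) * (1 / 2) ^ u / ((breaks A).factorial : ℚ)) *
        (descPochhammer ℚ (breaks A)).comp (Polynomial.X + Polynomial.C ((1 : ℚ) - u))).coeff (2 * j - 4) = 0 := by
  by_cases hne : (shapeClass j u A).card = 0
  · rw [symbolPoly_term_eq_zero_of_card_eq_zero j u A hne, Polynomial.coeff_zero]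
  · obtain ⟨κ, hκ⟩ := Finset.card_pos.1 (Nat.pos_of_ne_zero hne)
    have h3 := breaks_add_three_le_of_mem_shapeClass hκ
    have hu2 : u ≤ 2 * j := by
      by_contra h'
      rw [shapeClass_eq_empty j u A (by omega)] at hκ
      simp at hκ
    by_cases hb : breaks A < 2 * j - 4
    · exact coeff_symbolPoly_term_eq_zero_of_breaks_lt j u A hb
    · exfalso; apply h; omega

open Classical Polynomial in
/-- The top corner one below its top: for `breaks A = 2j − 3` on `u = 2j` letters, `[X^{2j−4}]` of the term is
`#class · 2^{−2j}/(2j−3)! · (−3(2j−3)(j−1))` (the second coefficient of `(X)_{2j−3} ∘ (X + 1 − 2j)`). [cite: MadrasSlade1993, Definition 1.2.4; lane plumbing] -/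
theorem coeff_symbolPoly_term_top_sub_four (j : ℕ) (hj : 2 ≤ j) (A : Fin (2 * j) → Bool) (hb : breaks A = 2 * j - 3) :
    (Polynomial.C (((shapeClass j (2 * j) A).card : ℚ) * (1 / 2) ^ (2 * j) / ((breaks A).factorial : ℚ)) *
        (descPochhammer ℚ (breaks A)).comp (Polynomial.X + Polynomial.C ((1 : ℚ) - (2 * j : ℕ)))).coeff (2 * j - 4)
      = ((shapeClass j (2 * j) A).card : ℚ) * (1 / 2) ^ (2 * j) / ((2 * j - 3).factorial : ℚ) * (-(3 * ((2 * j - 3 : ℕ) : ℚ) * ((j - 1 : ℕ) : ℚ))) := by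
  rw [Polynomial.coeff_C_mul, hb]
  obtain ⟨k, rfl⟩ : ∃ k, j = k + 2 := ⟨j - 2, by omega⟩
  have e1 : 2 * (k + 2) - 3 = (2 * k) + 1 := by omega
  have e2 : 2 * (k + 2) - 4 = 2 * k := by omega
  have e3 : k + 2 - 1 = k + 1 := by omega
  rw [e1, e2, e3, coeff_descPochhammer_succ_comp_X_add_C]
  push_cast
  ring

open Classical Polynomial in
/-- A corner with `breaks A = 2j − 4`: the term's `X^{2j−4}` coefficient is its top one, `#class · 2^{−u}/(2j−4)!`.
[cite: MadrasSlade1993, Definition 1.2.4; lane plumbing] -/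
theorem coeff_symbolPoly_term_second (j u : ℕ) (A : Fin u → Bool) (hb : breaks A = 2 * j - 4) :
    (Polynomial.C (((shapeClass j u A).card : ℚ) * (1 / 2) ^ u / ((breaks A).factorial : ℚ)) *
        (descPochhammer ℚ (breaks A)).comp (Polynomial.X + Polynomial.C ((1 : ℚ) - u))).coeff (2 * j - 4)
      = ((shapeClass j u A).card : ℚ) * (1 / 2) ^ u / ((2 * j - 4).factorial : ℚ) := by
  rw [Polynomial.coeff_C_mul, hb]
  set p : Polynomial ℚ := (descPochhammer ℚ (2 * j - 4)).comp (Polynomial.X + Polynomial.C ((1 : ℚ) - u)) with hp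
  have hmon : p.Monic := (monic_descPochhammer ℚ _).comp_X_add_C _
  have hdeg : p.natDegree = 2 * j - 4 := by
    rw [hp, Polynomial.natDegree_comp, descPochhammer_natDegree, Polynomial.natDegree_X_add_C, mul_one]
  have hc : p.coeff (2 * j - 4) = 1 := by
    have := hmon.coeff_natDegree; rwa [hdeg] at this
  rw [hc, mul_one]

/-! ### ★★★ The second coefficient of `R_j` -/

open Classical Polynomial in
/-- ★★★ THE SECOND COEFFICIENT OF THE SYMBOL POLYNOMIAL IS λ's TOP SUM PLUS TWO NEW SHAPE SUMS: for every `j ≥ 2`,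
`[X^{2j−4}] R_j = S_j · 2^{−2j}/(2j−3)! · (−3(2j−3)(j−1)) + U'_j · 2^{−2j}/(2j−4)! + V'_j · 2^{−(2j−1)}/(2j−4)!`
with `S_j = topShapeSum j` (λ: `= (2j−3)(2j−5)‼2^{2j−2}`), `U'_j = secondShapeSumTop j`, `V'_j = secondShapeSumBelow j` — only the corners
`(u, breaks) = (2j, 2j−3), (2j, 2j−4), (2j−1, 2j−4)` reach `X^{2j−4}` (a non-empty class has `breaks + 3 ≤ u ≤ 2j`). The lane's census gives
`[X^{2j−4}] R_j = −9/8, −53/96, −29/192, −645/23040` for `j = 3…6` (tree `symbolPoly_four/five/six`), matching the predicted closed forms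
`U'_j = (2j−4)(4j−7)(2j−5)‼2^{2j−3}`, `V'_j = (2j−4)(j+3)(2j−5)‼2^{2j−3}/3` ⇒ `[X^{2j−4}] R_j = −(4j² − 2j − 3)/(3·2^j·(j−2)!)` (FINDING-ZD-SYMBOL-POLYNOMIALITY §15;
the two closed forms are OPEN as all-`j` theorems). [cite: MadrasSlade1993, §1.1 eq. (1.1.8) p. 5; Definition 1.2.4] [cite: ClisbyLiangSlade2007, §3.3 eqs. (29)/(31); lane theorem] -/
theorem coeff_symbolPoly_two_mul_sub_four (j : ℕ) (hj : 2 ≤ j) :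
    (symbolPoly j).coeff (2 * j - 4) =
      (topShapeSum j : ℚ) * (1 / 2) ^ (2 * j) / ((2 * j - 3).factorial : ℚ) * (-(3 * ((2 * j - 3 : ℕ) : ℚ) * ((j - 1 : ℕ) : ℚ)))
      + (secondShapeSumTop j : ℚ) * (1 / 2) ^ (2 * j) / ((2 * j - 4).factorial : ℚ)
      + (secondShapeSumBelow j : ℚ) * (1 / 2) ^ (2 * j - 1) / ((2 * j - 4).factorial : ℚ) := by
  unfold symbolPoly topShapeSum secondShapeSumTop secondShapeSumBelow
  have hsplit : Finset.range (2 * j + 1) = Finset.range (2 * j - 1) ∪ {2 * j - 1, 2 * j} := by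
    ext u; simp only [Finset.mem_range, Finset.mem_union, Finset.mem_insert, Finset.mem_singleton]; omega
  rw [Polynomial.finsetSum_coeff, hsplit, Finset.sum_union (by
    rw [Finset.disjoint_left]; intro u hu hu'
    simp only [Finset.mem_range] at hu; simp only [Finset.mem_insert, Finset.mem_singleton] at hu'; omega)]
  rw [Finset.sum_eq_zero (fun u hu => ?_), zero_add, Finset.sum_pair (by omega)]
  · -- the two top slices
    rw [Polynomial.finsetSum_coeff, Polynomial.finsetSum_coeff, Nat.cast_sum, Nat.cast_sum, Nat.cast_sum, Finset.sum_mul, Finset.sum_div,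
      Finset.sum_mul, Finset.sum_mul, Finset.sum_div, Finset.sum_mul, Finset.sum_div, ← Finset.sum_add_distrib, add_comm]
    congr 1
    · -- `u = 2j`: corners `breaks = 2j − 3` (one below its top) and `breaks = 2j − 4` (its top)
      refine Finset.sum_congr rfl fun A _ => ?_
      by_cases hv : AdjValid A
      · rw [if_pos hv]
        by_cases hb3 : breaks A = 2 * j - 3
        · rw [if_pos ⟨hv, hb3⟩, if_neg (fun h => by omega), coeff_symbolPoly_term_top_sub_four j hj A hb3]
          push_cast; ring
        · by_cases hb4 : breaks A = 2 * j - 4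
          · rw [if_neg (fun h => hb3 h.2), if_pos ⟨hv, hb4⟩, coeff_symbolPoly_term_second j (2 * j) A hb4]
            push_cast; ring
          · rw [if_neg (fun h => hb3 h.2), if_neg (fun h => hb4 h.2), coeff_symbolPoly_term_sub_four_eq_zero j (2 * j) A hj (by omega)]
            push_cast; ring
      · rw [if_neg hv, if_neg (fun h => hv h.1), if_neg (fun h => hv h.1)]
        simp
    · -- `u = 2j − 1`: the corner `breaks = 2j − 4`
      refine Finset.sum_congr rfl fun A _ => ?_
      by_cases hv : AdjValid A
      · rw [if_pos hv]
        by_cases hb4 : breaks A = 2 * j - 4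
        · rw [if_pos ⟨hv, hb4⟩, coeff_symbolPoly_term_second j (2 * j - 1) A hb4]
        · rw [if_neg (fun h => hb4 h.2), coeff_symbolPoly_term_sub_four_eq_zero j (2 * j - 1) A hj (by omega)]
          push_cast; ring
      · rw [if_neg hv, if_neg (fun h => hv h.1)]
        simp
  · -- the slices `u < 2j − 1` do not reach `X^{2j−4}`
    have hu' : u < 2 * j - 1 := Finset.mem_range.1 hu
    rw [Polynomial.finsetSum_coeff]
    refine Finset.sum_eq_zero fun A _ => ?_
    by_cases hv : AdjValid A
    · rw [if_pos hv]
      exact coeff_symbolPoly_term_sub_four_eq_zero j u A hj (by omega)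
    · rw [if_neg hv]; simp

/-- ★★ THE SECOND-LAYER LAW, CONDITIONAL FORM: if the two second-layer shape sums have the predicted closed forms
`U'_j = (2j−4)(4j−7)(2j−5)‼·2^{2j−3}` and `3·V'_j = (2j−4)(j+3)(2j−5)‼·2^{2j−3}` (kernel-census facts for `j ≤ 7`, FINDING-ZD-SYMBOL-POLYNOMIALITY §15),
then `[X^{2j−4}] R_j = −(4j² − 2j − 3)/(3·2^j·(j−2)!)` (`j ≥ 2`). [cite: MadrasSlade1993, §1.1 eq. (1.1.8) p. 5; Definition 1.2.4]
[cite: ClisbyLiangSlade2007, §3.3 eqs. (29)/(31); lane theorem] -/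
theorem coeff_symbolPoly_two_mul_sub_four_of_sums (j : ℕ) (hj : 2 ≤ j)
    (hU : secondShapeSumTop j = (2 * j - 4) * (4 * j - 7) * ((2 * j - 5).doubleFactorial * 2 ^ (2 * j - 3)))
    (hV : 3 * secondShapeSumBelow j = (2 * j - 4) * (j + 3) * ((2 * j - 5).doubleFactorial * 2 ^ (2 * j - 3))) :
    (symbolPoly j).coeff (2 * j - 4) = -((4 * (j : ℚ) ^ 2 - 2 * j - 3) / (3 * 2 ^ j * ((j - 2).factorial : ℚ))) := by
  have hV' : (secondShapeSumBelow j : ℚ) = ((2 * j - 4 : ℕ) : ℚ) * ((j : ℚ) + 3) * (((2 * j - 5).doubleFactorial : ℚ) * 2 ^ (2 * j - 3)) / 3 := by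
    have := congrArg (fun x : ℕ => (x : ℚ)) hV
    push_cast at this ⊢
    linarith
  rw [coeff_symbolPoly_two_mul_sub_four j hj, topShapeSum_eq j hj, hU, hV']
  obtain ⟨k, rfl⟩ : ∃ k, j = k + 2 := ⟨j - 2, by omega⟩
  have e1 : 2 * (k + 2) - 3 = 2 * k + 1 := by omega
  have e2 : 2 * (k + 2) - 5 = 2 * k - 1 := by omega
  have e3 : 2 * (k + 2) - 2 = 2 * k + 2 := by omega
  have e4 : k + 2 - 2 = k := by omega
  have e5 : 2 * (k + 2) - 4 = 2 * k := by omega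
  have e6 : k + 2 - 1 = k + 1 := by omega
  have e7 : 2 * (k + 2) - 1 = 2 * k + 3 := by omega
  have e8 : 4 * (k + 2) - 7 = 4 * k + 1 := by omega
  rw [e1, e2, e3, e4, e5, e6, e7, e8]
  -- `(2k+1)! = (2k+1)‼ (2k)‼ = (2k+1)(2k−1)‼ · 2^k k!`, `(2k)! = (2k−1)‼ · 2^k k!`
  have hD : ((2 * k + 1).factorial : ℚ) = (2 * k + 1) * ((2 * k - 1).doubleFactorial : ℚ) * (2 ^ k * (k.factorial : ℚ)) := by
    rw [Nat.factorial_eq_mul_doubleFactorial, ← two_mul_add_one_mul_doubleFactorial k, Nat.doubleFactorial_two_mul]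
    push_cast; ring
  have hE : ((2 * k).factorial : ℚ) = ((2 * k - 1).doubleFactorial : ℚ) * (2 ^ k * (k.factorial : ℚ)) := by
    cases k with
    | zero => simp
    | succ k =>
      rw [show 2 * (k + 1) = (2 * k + 1) + 1 by ring, Nat.factorial_eq_mul_doubleFactorial, show 2 * k + 1 + 1 - 1 = 2 * k + 1 by omega,
        show 2 * k + 1 + 1 = 2 * (k + 1) by ring, Nat.doubleFactorial_two_mul]
      push_cast; ring
  rw [hD, hE]
  have hDf : ((2 * k - 1).doubleFactorial : ℚ) ≠ 0 := by exact_mod_cast (Nat.doubleFactorial_pos _).ne'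
  have hk : (k.factorial : ℚ) ≠ 0 := by exact_mod_cast k.factorial_ne_zero
  have h2k : (2 : ℚ) ^ k ≠ 0 := pow_ne_zero _ two_ne_zero
  push_cast
  simp only [one_div, inv_pow]
  field_simp
  ring

end WordTypes

end Literature.Probability.RandomPlanarGeometry.SAW.Zd
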